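import Mathlib
import Literature.Geometry.Symplectic.JHolomorphicMap
import HarnessLib

/-!
# Generalized Weierstraß theorem for `J`-holomorphic maps: a-priori calculus, energy identities

Part 1/3 of the Literature proof of the named fact
`Literature.Geometry.Symplectic.JHolomorphicWeierstrassR4` (C. Hummel, *Gromov's compactness
theorem for pseudo-holomorphic curves* (1997), Ch. III Prop. 3.1, flat form; McDuff–Salamon
(2012), Thm B.4.2: a `C⁰`-convergent sequence of `J`-holomorphic maps converges in `C¹` and the
limit is `J`-holomorphic), by `L²` elliptic bootstrapping for the non-linear Cauchy–Riemann
equation `dg(i ζ) = J(g) dg(ζ)`: this file holds the calculus of iterated derivatives of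
`J`-holomorphic maps (`Apriori.*`: Leibniz estimates, the differentiated equation as a linear
Cauchy–Riemann system with a source term, and the energy identity / two integrations by parts on
discs with cut-offs). Everything is stated for maps `ℂ → EuclideanSpace ℝ (Fin d)` (any `d`).

Provenance: these are the Summits-side files
`Theorems/SullivanDualTameOrBrodyR4Apriori{Calculus,Source,Energy}.lean` of summit
`SmoothPoincare4` (crux `TameOrBrodyR4`, where the chain was first built and discharged the fact
Summits-side as `…WitnessCharge…jHolomorphicWeierstrassR4_holds`), re-homed verbatim into
Literature (namespace `Literature.Geometry.Symplectic.JHolomorphicWeierstrassProof`, dimension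
`4` generalised to `d`) so that Literature consumers of the fact — the local intersection theory
of `J`-holomorphic curves, `JHolomorphicLocalIntersections.lean` — can import its proof
(promotion request event 3680949). The original module headers are kept below as section
headers; they refer to the stubs/lines of that crux.

## References

* C. Hummel, *Gromov's Compactness Theorem for Pseudo-holomorphic Curves*, Progress in Math. 151
  (1997), Ch. III Prop. 3.1. [Hummel1997]
* D. McDuff, D. Salamon, *J-holomorphic curves and symplectic topology*, 2nd ed. (2012),
  Thm B.4.2. [McDuffSalamon2012]
-/

noncomputable section

/-!
## Part `SullivanDualTameOrBrodyR4AprioriCalculus`: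
### A-priori estimate for `J`-holomorphic maps, part 1: calculus of word derivatives

Helper file of the lead (c2) for stub `stub_aprioriOf` of line `Sketch`, crux `TameOrBrodyR4`
(stmt-SmoothPoincare4-7826, route SullivanDual). Directional derivatives `(fderiv ℝ u · v)` on
`ℂ = ℝ²`, their commutation (symmetry of second derivatives), the word derivatives
`(iteratedFDeriv ℝ n u · m)` for a constant tuple `m` (one more letter = one more directional
derivative in front; directional derivatives pass inside), the word form `∂₂ g = (J ∘ g) ∂₁ g` of
flat `J`-holomorphicity (`∂₁ = d·(1)`, `∂₂ = d·(i)`), the commutator identity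
`∂₂ w - (J ∘ g) ∂₁ w = (Dⁿ((J∘g) ∂₁g) - (J∘g) ∘ Dⁿ∂₁g)(m)` for `w = Dⁿg · m`, and its Leibniz
bound (only derivatives of `J ∘ g` of order `≥ 1` enter). No new definitions; Mathlib only
(`second_derivative_symmetric`, `iteratedFDeriv_succ_apply_left`, `norm_iteratedFDeriv_clm_apply`,
`ContinuousLinearMap.iteratedFDeriv_comp_left`).
-/

open scoped ContDiff Topology Nat
open Filter Set Literature.Geometry.Symplectic

namespace Literature.Geometry.Symplectic.JHolomorphicWeierstrassProof

variable {d : ℕ}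
namespace Apriori

variable {F : Type*} [NormedAddCommGroup F] [NormedSpace ℝ F]

/-! ### Directional and word derivatives -/

/-- A directional derivative `(du · v)` of a `C^∞` map is `C^∞`. [folklore] -/
theorem contDiff_fderiv_apply {u : ℂ → F} (hu : ContDiff ℝ ∞ u) (v : ℂ) :
    ContDiff ℝ ∞ (fderiv ℝ u · v) :=
  (hu.fderiv_right (m := ∞) (by simp)).clm_apply contDiff_const

/-- `∂_v ∂_w u (z) = D²u(z)(v)(w)`. [folklore] -/
theorem fderiv_fderiv_apply_eq {u : ℂ → F} (hu : ContDiff ℝ ∞ u) (v w z : ℂ) :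
    fderiv ℝ (fderiv ℝ u · w) z v = fderiv ℝ (fderiv ℝ u) z v w := by
  have hd : DifferentiableAt ℝ (fderiv ℝ u) z :=
    ((hu.fderiv_right (m := ∞) (by simp)).differentiable (by simp)).differentiableAt
  show fderiv ℝ (fun y => fderiv ℝ u y w) z v = _
  rw [fderiv_clm_apply hd (differentiableAt_const _)]
  simp

/-- **Directional derivatives of a `C^∞` map commute.** [folklore] -/
theorem fderiv_apply_comm {u : ℂ → F} (hu : ContDiff ℝ ∞ u) (v w : ℂ) :
    (fderiv ℝ (fderiv ℝ u · w) · v) = (fderiv ℝ (fderiv ℝ u · v) · w) := by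
  funext z
  show fderiv ℝ (fderiv ℝ u · w) z v = fderiv ℝ (fderiv ℝ u · v) z w
  rw [fderiv_fderiv_apply_eq hu, fderiv_fderiv_apply_eq hu]
  have h1 : ∀ y, HasFDerivAt u (fderiv ℝ u y) y := fun y =>
    ((hu.differentiable (by simp)) y).hasFDerivAt
  have h2 : HasFDerivAt (fderiv ℝ u) (fderiv ℝ (fderiv ℝ u) z) z :=
    (((hu.fderiv_right (m := ∞) (by simp)).differentiable (by simp)) z).hasFDerivAt
  exact second_derivative_symmetric h1 h2 _ _

/-- A word derivative `(Dⁿu · m)` of a `C^∞` map is `C^∞`. [folklore] -/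
theorem contDiff_iteratedFDeriv_apply {u : ℂ → F} (hu : ContDiff ℝ ∞ u) (n : ℕ)
    (m : Fin n → ℂ) : ContDiff ℝ ∞ (iteratedFDeriv ℝ n u · m) :=
  (ContinuousMultilinearMap.apply ℝ (fun _ : Fin n => ℂ) F m).contDiff.comp
    (hu.iteratedFDeriv_right (i := n) (m := ∞) (mod_cast le_top))

/-- **One more letter is one more directional derivative in front:**
`D^{n+1}u(z)(m) = ∂_{m 0} (Dⁿu · tail m)(z)`. [folklore] -/
theorem iteratedFDeriv_succ_apply_eq_fderiv {u : ℂ → F} (hu : ContDiff ℝ ∞ u) (n : ℕ)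
    (m : Fin (n + 1) → ℂ) (z : ℂ) :
    iteratedFDeriv ℝ (n + 1) u z m = fderiv ℝ (iteratedFDeriv ℝ n u · (Fin.tail m)) z (m 0) := by
  rw [iteratedFDeriv_succ_apply_left]
  show _ = fderiv ℝ (fun y => iteratedFDeriv ℝ n u y (Fin.tail m)) z (m 0)
  rw [fderiv_continuousMultilinear_apply_const_apply]
  exact (hu.differentiable_iteratedFDeriv (m := n) (mod_cast ENat.coe_lt_top n)).differentiableAt

/-- **Directional derivatives pass inside word derivatives:**
`∂_v (Dⁿu · m) = Dⁿ(∂_v u) · m`. [folklore] -/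
theorem fderiv_iteratedFDeriv_apply_comm {u : ℂ → F} (hu : ContDiff ℝ ∞ u) (v : ℂ) :
    ∀ (n : ℕ) (m : Fin n → ℂ),
      (fderiv ℝ (iteratedFDeriv ℝ n u · m) · v) = (iteratedFDeriv ℝ n (fderiv ℝ u · v) · m)
  | 0, m => by
    funext z
    have h0 : (iteratedFDeriv ℝ 0 u · m) = u := funext fun y => iteratedFDeriv_zero_apply m
    show fderiv ℝ (iteratedFDeriv ℝ 0 u · m) z v = iteratedFDeriv ℝ 0 (fderiv ℝ u · v) z m
    rw [h0, iteratedFDeriv_zero_apply]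
  | n + 1, m => by
    have hsucc : (iteratedFDeriv ℝ (n + 1) u · m) =
        (fderiv ℝ (iteratedFDeriv ℝ n u · (Fin.tail m)) · (m 0)) :=
      funext fun z => iteratedFDeriv_succ_apply_eq_fderiv hu n m z
    have hsucc' : (iteratedFDeriv ℝ (n + 1) (fderiv ℝ u · v) · m) =
        (fderiv ℝ (iteratedFDeriv ℝ n (fderiv ℝ u · v) · (Fin.tail m)) · (m 0)) :=
      funext fun z => iteratedFDeriv_succ_apply_eq_fderiv (contDiff_fderiv_apply hu v) n m z
    rw [hsucc, hsucc', fderiv_apply_comm (contDiff_iteratedFDeriv_apply hu n _),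
      fderiv_iteratedFDeriv_apply_comm hu v n (Fin.tail m)]

/-- `‖e_i‖ = 1` for the real basis `e₀ = 1`, `e₁ = i` of `ℂ`. [folklore] -/
theorem norm_basis_eq_one (i : Fin 2) : ‖(![(1 : ℂ), Complex.I] : Fin 2 → ℂ) i‖ = 1 := by
  fin_cases i <;> simp

/-- `‖Dⁿu(z)(e_L)‖ ≤ ‖Dⁿu(z)‖` on basis tuples. [folklore] -/
theorem norm_iteratedFDeriv_apply_basis_le (u : ℂ → F) (n : ℕ) (L : Fin n → Fin 2) (z : ℂ) :
    ‖iteratedFDeriv ℝ n u z (fun j => ![(1 : ℂ), Complex.I] (L j))‖ ≤ ‖iteratedFDeriv ℝ n u z‖ := by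
  refine (ContinuousMultilinearMap.le_opNorm _ _).trans ?_
  simp [norm_basis_eq_one]

/-! ### The equation and the commutator source term -/

/-- The flat `J`-holomorphicity equation in word form: `∂₂ g = (J ∘ g) ∂₁ g`. [folklore] -/
theorem fderiv_apply_I_eq_of_isJHolomorphicFlat {E : Type*} [NormedAddCommGroup E]
    [NormedSpace ℝ E] {J : E → E →L[ℝ] E} {g : ℂ → E} (hgJ : IsJHolomorphicFlat J g) :
    (fderiv ℝ g · Complex.I) = fun z => J (g z) (fderiv ℝ g z 1) := by
  funext z
  have h := hgJ z 1
  rw [mul_one] at h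
  exact h

/-- **The commutator identity.** For a flat-`J`-holomorphic `C^∞` map `g` with `A = J ∘ g` and
`p = ∂₁ g`, the word derivative `w = Dⁿg · m` satisfies
`∂₂ w (z) - A(z) (∂₁ w (z)) = (Dⁿ(A p)(z) - A(z) ∘ Dⁿp(z))(m)`. [folklore] -/
theorem commutator_identity {E : Type*} [NormedAddCommGroup E] [NormedSpace ℝ E]
    {J : E → E →L[ℝ] E} {g : ℂ → E} (hg : ContDiff ℝ ∞ g)
    (hgJ : IsJHolomorphicFlat J g) (n : ℕ) (m : Fin n → ℂ) (z : ℂ) :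
    fderiv ℝ (iteratedFDeriv ℝ n g · m) z Complex.I -
        J (g z) (fderiv ℝ (iteratedFDeriv ℝ n g · m) z 1) =
      (iteratedFDeriv ℝ n (fun y => J (g y) (fderiv ℝ g y 1)) z -
        (J (g z)).compContinuousMultilinearMap (iteratedFDeriv ℝ n (fderiv ℝ g · 1) z)) m := by
  have hI := congrFun (fderiv_iteratedFDeriv_apply_comm hg Complex.I n m) z
  have h1 := congrFun (fderiv_iteratedFDeriv_apply_comm hg 1 n m) z
  rw [hI, h1, fderiv_apply_I_eq_of_isJHolomorphicFlat hgJ, sub_apply,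
    ContinuousLinearMap.compContinuousMultilinearMap_coe, Function.comp_apply]

/-- **Leibniz bound for the commutator** `Dⁿ(A p)(z) - A(z) ∘ Dⁿp(z)`: only derivatives of `A`
of order `≥ 1` enter (apply the bilinear bound to `y ↦ (A y - A z) (p y)`). [folklore] -/
theorem norm_commutator_le {A : ℂ → F →L[ℝ] F} {p : ℂ → F} (hA : ContDiff ℝ ∞ A)
    (hp : ContDiff ℝ ∞ p) (n : ℕ) (z : ℂ) :
    ‖iteratedFDeriv ℝ n (fun y => A y (p y)) z -
        (A z).compContinuousMultilinearMap (iteratedFDeriv ℝ n p z)‖ ≤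
      ∑ i ∈ Finset.range n, (n.choose (i + 1) : ℝ) * ‖iteratedFDeriv ℝ (i + 1) A z‖ *
        ‖iteratedFDeriv ℝ (n - (i + 1)) p z‖ := by
  set A' : ℂ → F →L[ℝ] F := fun y => A y - A z with hA'def
  have hA' : ContDiff ℝ ∞ A' := hA.sub contDiff_const
  have hsplit : (fun y => A y (p y)) = (fun y => A' y (p y)) + fun y => A z (p y) := by
    funext y
    simp [A']
  have h1 : iteratedFDeriv ℝ n (fun y => A y (p y)) z =
      iteratedFDeriv ℝ n (fun y => A' y (p y)) z + iteratedFDeriv ℝ n (fun y => A z (p y)) z := by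
    rw [hsplit]
    exact iteratedFDeriv_add_apply ((hA'.clm_apply hp).contDiffAt.of_le (mod_cast le_top))
      ((contDiff_const.clm_apply hp).contDiffAt.of_le (mod_cast le_top))
  have h2 : iteratedFDeriv ℝ n (fun y => A z (p y)) z =
      (A z).compContinuousMultilinearMap (iteratedFDeriv ℝ n p z) :=
    (A z).iteratedFDeriv_comp_left (f := p) (hp.contDiffAt.of_le (mod_cast le_top)) le_rfl
  rw [h1, h2, add_sub_cancel_right]
  refine (norm_iteratedFDeriv_clm_apply (N := ∞) hA' hp z (mod_cast le_top)).trans (le_of_eq ?_)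
  rw [Finset.sum_range_succ']
  have h0 : ‖iteratedFDeriv ℝ 0 A' z‖ = 0 := by simp [A']
  rw [h0]
  simp only [mul_zero, zero_mul, add_zero]
  refine Finset.sum_congr rfl fun i _ => ?_
  congr 2
  have : A' = A - fun _ => A z := rfl
  rw [this, iteratedFDeriv_sub_apply (hA.contDiffAt.of_le (mod_cast le_top))
    (contDiffAt_const.of_le (mod_cast le_top)), iteratedFDeriv_succ_const, Pi.zero_apply, sub_zero]

/-- `‖D^j (du · v)(z)‖ ≤ ‖v‖ ‖D^{j+1} u (z)‖`. [folklore] -/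
theorem norm_iteratedFDeriv_fderiv_apply_le {u : ℂ → F} (hu : ContDiff ℝ ∞ u) (v : ℂ) (j : ℕ)
    (z : ℂ) : ‖iteratedFDeriv ℝ j (fderiv ℝ u · v) z‖ ≤ ‖v‖ * ‖iteratedFDeriv ℝ (j + 1) u z‖ := by
  have h := norm_iteratedFDeriv_clm_apply_const (f := fderiv ℝ u) (c := v) (x := z) (N := ∞)
    (n := j) ((hu.fderiv_right (m := ∞) (by simp)).contDiffAt) (mod_cast le_top)
  rw [norm_iteratedFDeriv_fderiv] at h
  exact h

end Apriori

end Literature.Geometry.Symplectic.JHolomorphicWeierstrassProof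

/-!
## Part `SullivanDualTameOrBrodyR4AprioriSource`:
### A-priori estimate for `J`-holomorphic maps, part 2: the pointwise source bound

Helper file of the lead (c2) for stub `stub_aprioriOf` of line `Sketch`, crux `TameOrBrodyR4`
(stmt-SmoothPoincare4-7826, route SullivanDual). Faà di Bruno bound for `Dᵏ(J ∘ g)` with the
orders `≤ k - 2` of `g` frozen (linear in `‖Dᵏg‖`, quadratic in `‖D^{k-1}g‖`; from
`norm_iteratedFDeriv_comp_le` with `D = max(S, a_{k-1}^{1/(k-1)}, a_k^{1/k})`), and the resulting
pointwise bound `source_le` (registered sub-goal) for the commutator source term of the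
bootstrapping: `‖Dⁿ((J∘g) ∂₁g)(z) - (J∘g)(z) ∘ Dⁿ∂₁g(z)‖ ≤ C(n, M, S) (1 + ‖D^{n-1}g(z)‖² + ‖Dⁿg(z)‖)`
when `‖DⁱJ‖ ≤ M` at `g z` (`i ≤ n`), `‖D¹g(z)‖ ≤ 2` and `‖Dⁱg(z)‖ ≤ S` for `1 ≤ i ≤ n - 2`, with the
explicit constant `C = ∑_{j<n} C(n,j+1) (j+1)! M (S^{j+1} + 1 + S² + S) (2S)`.
-/

open scoped ContDiff Topology Nat
open Filter Set Literature.Geometry.Symplectic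

namespace Literature.Geometry.Symplectic.JHolomorphicWeierstrassProof

variable {d : ℕ}
namespace Apriori

/-! ### Faà di Bruno bounds for `A = J ∘ g` -/

/-- `(max x y)^k ≤ x^k + y^k` for `x, y ≥ 0`. [folklore] -/
theorem max_pow_le_add {x y : ℝ} (hx : 0 ≤ x) (hy : 0 ≤ y) (k : ℕ) :
    max x y ^ k ≤ x ^ k + y ^ k := by
  rcases le_total x y with h | h
  · rw [max_eq_right h]; linarith [pow_nonneg hx k]
  · rw [max_eq_left h]; linarith [pow_nonneg hy k]

/-- `a · a^{1/m} ≤ 1 + a²` for `a ≥ 0`, `m ≥ 1`. [folklore] -/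
theorem mul_rpow_inv_le {a : ℝ} (ha : 0 ≤ a) {m : ℕ} (hm : 1 ≤ m) :
    a * a ^ ((m : ℝ)⁻¹) ≤ 1 + a ^ 2 := by
  have hexp0 : 0 ≤ (m : ℝ)⁻¹ := by positivity
  have hexp1 : (m : ℝ)⁻¹ ≤ 1 := inv_le_one_of_one_le₀ (by exact_mod_cast hm)
  rcases le_total a 1 with h | h
  · have : a ^ ((m : ℝ)⁻¹) ≤ 1 := Real.rpow_le_one ha h hexp0
    nlinarith [Real.rpow_nonneg ha ((m : ℝ)⁻¹)]
  · have : a ^ ((m : ℝ)⁻¹) ≤ a := by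
      conv_rhs => rw [← Real.rpow_one a]
      exact Real.rpow_le_rpow_of_exponent_le h hexp1
    nlinarith

/-- **Faà di Bruno bound, order `k ≥ 2`, with frozen lower orders.** If `‖DⁱJ‖ ≤ M` at `g z` for
`i ≤ k` and `‖Dⁱg(z)‖ ≤ S` (`S ≥ 1`) for `1 ≤ i ≤ k - 2`, then
`‖Dᵏ(J ∘ g)(z)‖ ≤ k! M (Sᵏ + 1 + ‖D^{k-1}g(z)‖² + ‖Dᵏg(z)‖)` — linear in the top order,
quadratic in the next one (from `norm_iteratedFDeriv_comp_le` with
`D = max(S, a_{k-1}^{1/(k-1)}, a_k^{1/k})`). [folklore] -/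
theorem norm_iteratedFDeriv_comp_le_frozen {E G : Type*} [NormedAddCommGroup E] [NormedSpace ℝ E]
    [NormedAddCommGroup G] [NormedSpace ℝ G] {J : E → G} {g : ℂ → E} (hJ : ContDiff ℝ ∞ J)
    (hg : ContDiff ℝ ∞ g) {k : ℕ} (hk : 2 ≤ k) {M S : ℝ} (hS : 1 ≤ S) (z : ℂ)
    (hM : ∀ i, i ≤ k → ‖iteratedFDeriv ℝ i J (g z)‖ ≤ M)
    (hlow : ∀ i, 1 ≤ i → i + 2 ≤ k → ‖iteratedFDeriv ℝ i g z‖ ≤ S) :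
    ‖iteratedFDeriv ℝ k (fun y => J (g y)) z‖ ≤
      k ! * M * (S ^ k + 1 + ‖iteratedFDeriv ℝ (k - 1) g z‖ ^ 2 + ‖iteratedFDeriv ℝ k g z‖) := by
  set a := ‖iteratedFDeriv ℝ (k - 1) g z‖ with ha
  set b := ‖iteratedFDeriv ℝ k g z‖ with hb
  have ha0 : 0 ≤ a := norm_nonneg _
  have hb0 : 0 ≤ b := norm_nonneg _
  have hk1 : 1 ≤ k - 1 := by omega
  have hk0 : k ≠ 0 := by omega
  set α := a ^ (((k - 1 : ℕ) : ℝ)⁻¹) with hα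
  set β := b ^ (((k : ℕ) : ℝ)⁻¹) with hβ
  have hα0 : 0 ≤ α := Real.rpow_nonneg ha0 _
  have hβ0 : 0 ≤ β := Real.rpow_nonneg hb0 _
  set D := max S (max α β) with hD
  have hD1 : 1 ≤ D := hS.trans (le_max_left _ _)
  have hD0 : 0 ≤ D := zero_le_one.trans hD1
  have hM0 : 0 ≤ M := (norm_nonneg _).trans (hM 0 (Nat.zero_le _))
  -- the geometric hypothesis of `norm_iteratedFDeriv_comp_le`
  have hDpow : ∀ i, 1 ≤ i → i ≤ k → ‖iteratedFDeriv ℝ i g z‖ ≤ D ^ i := by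
    intro i hi1 hik
    rcases Nat.lt_or_ge (i + 1) k with hlt | hge
    · -- `i ≤ k - 2`
      calc ‖iteratedFDeriv ℝ i g z‖ ≤ S := hlow i hi1 (by omega)
        _ ≤ D := le_max_left _ _
        _ ≤ D ^ i := le_self_pow₀ hD1 (by omega)
    · rcases Nat.eq_or_lt_of_le hik with heq | hlt'
      · -- `i = k`
        subst heq
        calc ‖iteratedFDeriv ℝ i g z‖ = b := rfl
          _ = β ^ i := (Real.rpow_inv_natCast_pow hb0 hk0).symm
          _ ≤ D ^ i := pow_le_pow_left₀ hβ0 ((le_max_right _ _).trans (le_max_right _ _)) i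
      · -- `i = k - 1`
        have hi : i = k - 1 := by omega
        subst hi
        calc ‖iteratedFDeriv ℝ (k - 1) g z‖ = a := rfl
          _ = α ^ (k - 1) := (Real.rpow_inv_natCast_pow ha0 (by omega)).symm
          _ ≤ D ^ (k - 1) :=
            pow_le_pow_left₀ hα0 ((le_max_left _ _).trans (le_max_right _ _)) (k - 1)
  have hFdB : ‖iteratedFDeriv ℝ k (J ∘ g) z‖ ≤ k ! * M * D ^ k :=
    norm_iteratedFDeriv_comp_le (N := ∞) hJ hg (mod_cast le_top) z hM hDpow
  have hcomp : (fun y => J (g y)) = J ∘ g := rfl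
  rw [hcomp]
  refine hFdB.trans ?_
  have hDk : D ^ k ≤ S ^ k + 1 + a ^ 2 + b := by
    have h1 : D ^ k ≤ S ^ k + (α ^ k + β ^ k) :=
      calc D ^ k ≤ S ^ k + (max α β) ^ k :=
            max_pow_le_add (zero_le_one.trans hS) (le_max_of_le_left hα0) k
        _ ≤ S ^ k + (α ^ k + β ^ k) := by
            have := max_pow_le_add hα0 hβ0 k
            linarith
    have h2 : β ^ k = b := Real.rpow_inv_natCast_pow hb0 hk0
    have h3 : α ^ k ≤ 1 + a ^ 2 := by
      have hsplit : α ^ k = α ^ (k - 1) * α := by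
        conv_lhs => rw [show k = (k - 1) + 1 by omega, pow_succ]
      rw [hsplit, Real.rpow_inv_natCast_pow ha0 (by omega)]
      exact mul_rpow_inv_le ha0 hk1
    linarith
  have := mul_le_mul_of_nonneg_left hDk (by positivity : (0 : ℝ) ≤ k ! * M)
  linarith

/-- Chain-rule bound, order `1`: `‖D¹(J ∘ g)(z)‖ ≤ M ‖D¹g(z)‖`. [folklore] -/
theorem norm_iteratedFDeriv_one_comp_le {E G : Type*} [NormedAddCommGroup E] [NormedSpace ℝ E]
    [NormedAddCommGroup G] [NormedSpace ℝ G] {J : E → G} {g : ℂ → E} (hJ : ContDiff ℝ ∞ J)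
    (hg : ContDiff ℝ ∞ g) {M : ℝ} (z : ℂ) (hM : ∀ i, i ≤ 1 → ‖iteratedFDeriv ℝ i J (g z)‖ ≤ M) :
    ‖iteratedFDeriv ℝ 1 (fun y => J (g y)) z‖ ≤ M * ‖iteratedFDeriv ℝ 1 g z‖ := by
  have h := norm_iteratedFDeriv_comp_le (N := ∞) (n := 1) hJ hg (mod_cast le_top) z hM
    (D := ‖iteratedFDeriv ℝ 1 g z‖) (fun i hi1 hi2 => by
      obtain rfl : i = 1 := le_antisymm hi2 hi1
      rw [pow_one])
  have hcomp : (fun y => J (g y)) = J ∘ g := rfl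
  rw [hcomp]
  simpa using h

/-! ### The pointwise source bound with frozen lower orders -/

/-- The constant of `source_le` is nonnegative. [folklore] -/
theorem srcConst_nonneg (n : ℕ) {M S : ℝ} (hM : 0 ≤ M) (hS : 0 ≤ S) :
    0 ≤ ∑ j ∈ Finset.range n,
      (n.choose (j + 1) : ℝ) * (j + 1)! * M * (S ^ (j + 1) + 1 + S ^ 2 + S) * (2 * S) := by
  positivity
set_option maxHeartbeats 400000 in -- buildfix (bf3-g26): 160k/180k FAIL, 200k PASS at accept time; line-neutral budget line
/-- **Pointwise bound for the commutator source term.** With `A = J ∘ g`, `p = ∂₁ g`,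
`a_j = ‖Dʲg(z)‖`: if `‖DⁱJ(g z)‖ ≤ M` (`i ≤ n`), `a_1 ≤ 2`, and the orders `1 ≤ i ≤ n - 2` are
frozen (`a_i ≤ S`, `S ≥ 2`), then
`‖Dⁿ(A p)(z) - A(z) ∘ Dⁿp(z)‖ ≤ C(n, M, S) (1 + a_{n-1}² + a_n)`. [folklore] -/
theorem source_le {E : Type*} [NormedAddCommGroup E] [NormedSpace ℝ E] {J : E → E →L[ℝ] E}
    {g : ℂ → E} (hJs : ContDiff ℝ ∞ J) (hg : ContDiff ℝ ∞ g) {n : ℕ} (hn : 1 ≤ n) {M S : ℝ}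
    (hS : 2 ≤ S) (z : ℂ) (hM : ∀ i, i ≤ n → ‖iteratedFDeriv ℝ i J (g z)‖ ≤ M)
    (h1 : ‖iteratedFDeriv ℝ 1 g z‖ ≤ 2)
    (hlow : ∀ i, 1 ≤ i → i + 2 ≤ n → ‖iteratedFDeriv ℝ i g z‖ ≤ S) :
    ‖iteratedFDeriv ℝ n (fun y => J (g y) (fderiv ℝ g y 1)) z -
        (J (g z)).compContinuousMultilinearMap (iteratedFDeriv ℝ n (fderiv ℝ g · 1) z)‖ ≤
      (∑ j ∈ Finset.range n,
        (n.choose (j + 1) : ℝ) * (j + 1)! * M * (S ^ (j + 1) + 1 + S ^ 2 + S) * (2 * S)) *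
      (1 + ‖iteratedFDeriv ℝ (n - 1) g z‖ ^ 2 + ‖iteratedFDeriv ℝ n g z‖) := by
  have hM0 : 0 ≤ M := (norm_nonneg _).trans (hM 0 (Nat.zero_le _))
  have hS1 : 1 ≤ S := by linarith
  have hS0 : 0 ≤ S := by linarith
  have hA : ContDiff ℝ ∞ (fun y => J (g y)) := hJs.comp hg
  have hp : ContDiff ℝ ∞ (fderiv ℝ g · 1) := contDiff_fderiv_apply hg 1
  set a : ℕ → ℝ := fun j => ‖iteratedFDeriv ℝ j g z‖ with ha_def
  have ha0 : ∀ j, 0 ≤ a j := fun j => norm_nonneg _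
  set Λ := 1 + a (n - 1) ^ 2 + a n with hΛ
  have hΛ1 : 1 ≤ Λ := by
    have := ha0 (n - 1); have := ha0 n; simp only [hΛ]; nlinarith
  have han : a n ≤ Λ := by have := ha0 (n - 1); simp only [hΛ]; nlinarith
  have han1 : a (n - 1) ≤ Λ := by
    have := ha0 (n - 1); have := ha0 n; simp only [hΛ]; nlinarith
  refine (norm_commutator_le hA hp n z).trans ?_
  rw [Finset.sum_mul]
  refine Finset.sum_le_sum fun j hj => ?_
  have hjn : j < n := Finset.mem_range.mp hj
  -- the second factor: `‖D^{n-(j+1)} p‖ ≤ a (n - j)`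
  have hY : ‖iteratedFDeriv ℝ (n - (j + 1)) (fderiv ℝ g · 1) z‖ ≤ a (n - j) := by
    have h := norm_iteratedFDeriv_fderiv_apply_le hg 1 (n - (j + 1)) z
    rw [norm_one, one_mul] at h
    have hidx : n - j = n - (j + 1) + 1 := by omega
    rw [hidx]
    exact h
  have hY0 : 0 ≤ ‖iteratedFDeriv ℝ (n - (j + 1)) (fderiv ℝ g · 1) z‖ := norm_nonneg _
  have hX0 : 0 ≤ ‖iteratedFDeriv ℝ (j + 1) (fun y => J (g y)) z‖ := norm_nonneg _
  have hc0 : (0 : ℝ) ≤ (n.choose (j + 1) : ℝ) := by positivity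
  have hfac1 : (1 : ℝ) ≤ (j + 1)! := by exact_mod_cast Nat.one_le_iff_ne_zero.mpr (Nat.factorial_ne_zero _)
  have hPS : 0 ≤ S ^ (j + 1) := pow_nonneg hS0 _
  -- it suffices to bound `X * Y` by `(j+1)! M (S^(j+1) + 1 + S^2 + S) (2 S) Λ`
  suffices key : ‖iteratedFDeriv ℝ (j + 1) (fun y => J (g y)) z‖ *
      ‖iteratedFDeriv ℝ (n - (j + 1)) (fderiv ℝ g · 1) z‖ ≤
      (j + 1)! * M * (S ^ (j + 1) + 1 + S ^ 2 + S) * (2 * S) * Λ by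
    have := mul_le_mul_of_nonneg_left key hc0
    nlinarith [this]
  rcases Nat.eq_zero_or_pos j with hj0 | hjpos
  · -- `j = 0`: chain rule, `‖D¹A‖ ≤ M a₁ ≤ 2M`, second factor `a n ≤ Λ`
    subst hj0
    have hX : ‖iteratedFDeriv ℝ 1 (fun y => J (g y)) z‖ ≤ M * 2 :=
      (norm_iteratedFDeriv_one_comp_le hJs hg z fun i hi => hM i (hi.trans hn)).trans
        (mul_le_mul_of_nonneg_left h1 hM0)
    have hY' : ‖iteratedFDeriv ℝ (n - (0 + 1)) (fderiv ℝ g · 1) z‖ ≤ Λ := hY.trans (by simpa using han)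
    calc ‖iteratedFDeriv ℝ (0 + 1) (fun y => J (g y)) z‖ * ‖iteratedFDeriv ℝ (n - (0 + 1)) (fderiv ℝ g · 1) z‖
        ≤ (M * 2) * Λ := mul_le_mul hX hY' hY0 (by positivity)
      _ ≤ (0 + 1)! * M * (S ^ (0 + 1) + 1 + S ^ 2 + S) * (2 * S) * Λ := by
        apply mul_le_mul_of_nonneg_right _ (by linarith)
        simp only [zero_add, Nat.factorial_one, Nat.cast_one, one_mul, pow_one]
        have h2 : 2 ≤ (S + 1 + S ^ 2 + S) * (2 * S) := by nlinarith [sq_nonneg S]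
        have h3 := mul_le_mul_of_nonneg_left h2 hM0
        linarith
  · -- `j ≥ 1`: frozen Faà di Bruno at order `j + 1 ≥ 2`
    have hX : ‖iteratedFDeriv ℝ (j + 1) (fun y => J (g y)) z‖ ≤
        (j + 1)! * M * (S ^ (j + 1) + 1 + a j ^ 2 + a (j + 1)) := by
      have h := norm_iteratedFDeriv_comp_le_frozen hJs hg (k := j + 1) (by omega) hS1 z
        (fun i hi => hM i (by omega)) (fun i hi1 hi2 => hlow i hi1 (by omega))
      exact h
    have hfM : 0 ≤ ((j + 1)! : ℝ) * M := by positivity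
    generalize hP : S ^ (j + 1) = P at hX hPS
    -- reduce to an inequality between the two brackets
    suffices key2 : (P + 1 + a j ^ 2 + a (j + 1)) * a (n - j) ≤
        (P + 1 + S ^ 2 + S) * (2 * S) * Λ by
      calc ‖iteratedFDeriv ℝ (j + 1) (fun y => J (g y)) z‖ * ‖iteratedFDeriv ℝ (n - (j + 1)) (fderiv ℝ g · 1) z‖
          ≤ ((j + 1)! * M * (P + 1 + a j ^ 2 + a (j + 1))) * a (n - j) :=
            mul_le_mul hX hY hY0 (by positivity)
        _ = ((j + 1)! * M) * ((P + 1 + a j ^ 2 + a (j + 1)) * a (n - j)) := by ring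
        _ ≤ ((j + 1)! * M) * ((P + 1 + S ^ 2 + S) * (2 * S) * Λ) :=
            mul_le_mul_of_nonneg_left key2 hfM
        _ = (j + 1)! * M * (P + 1 + S ^ 2 + S) * (2 * S) * Λ := by ring
    have hP0 : 0 ≤ P := hPS
    have hΛ0 : 0 ≤ Λ := zero_le_one.trans hΛ1
    have hB0 : 0 ≤ P + 1 + S ^ 2 + S := by positivity
    rcases Nat.lt_or_ge (j + 1) n with hlt | hge
    · rcases Nat.lt_or_ge (j + 2) n with hlt2 | hge2
      · -- Case A, `j + 3 ≤ n`: `a j, a (j+1) ≤ S`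
        have haj : a j ≤ S := hlow j hjpos (by omega)
        have haj1 : a (j + 1) ≤ S := hlow (j + 1) (by omega) (by omega)
        have hbr : P + 1 + a j ^ 2 + a (j + 1) ≤ P + 1 + S ^ 2 + S := by
          have := pow_le_pow_left₀ (ha0 j) haj 2
          linarith
        have hbr0 : 0 ≤ P + 1 + a j ^ 2 + a (j + 1) := by positivity
        rcases Nat.lt_or_ge 1 j with hj2 | hj1
        · -- `j ≥ 2`: `a (n - j) ≤ S`
          have hanj : a (n - j) ≤ S := hlow (n - j) (by omega) (by omega)
          calc (P + 1 + a j ^ 2 + a (j + 1)) * a (n - j) ≤ (P + 1 + S ^ 2 + S) * S :=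
                mul_le_mul hbr hanj (ha0 _) hB0
            _ ≤ (P + 1 + S ^ 2 + S) * S * (2 * Λ) :=
                le_mul_of_one_le_right (by positivity) (by linarith)
            _ = (P + 1 + S ^ 2 + S) * (2 * S) * Λ := by ring
        · -- `j = 1`: `a (n - 1) ≤ Λ`
          have e : a (n - j) = a (n - 1) := by congr 1; omega
          calc (P + 1 + a j ^ 2 + a (j + 1)) * a (n - j) ≤ (P + 1 + S ^ 2 + S) * Λ := by
                rw [e]; exact mul_le_mul hbr han1 (ha0 _) hB0
            _ ≤ (P + 1 + S ^ 2 + S) * Λ * (2 * S) :=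
                le_mul_of_one_le_right (by positivity) (by linarith)
            _ = (P + 1 + S ^ 2 + S) * (2 * S) * Λ := by ring
      · -- Case B, `j + 2 = n`: the second factor is `a 2`, and `a (j + 1) = a (n - 1) ≤ Λ`
        have e1 : a (j + 1) = a (n - 1) := by congr 1; omega
        rcases Nat.lt_or_ge 1 j with hj2 | hj1
        · -- `j ≥ 2` (`n ≥ 4`): `a j ≤ S`, `a (n - j) = a 2 ≤ S`
          have haj : a j ≤ S := hlow j hjpos (by omega)
          have hanj : a (n - j) ≤ S := hlow (n - j) (by omega) (by omega)
          have hsq : a j ^ 2 ≤ S ^ 2 := pow_le_pow_left₀ (ha0 j) haj 2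
          have hbr : P + 1 + a j ^ 2 + a (j + 1) ≤ P + 1 + S ^ 2 + Λ := by rw [e1]; linarith
          calc (P + 1 + a j ^ 2 + a (j + 1)) * a (n - j) ≤ (P + 1 + S ^ 2 + Λ) * S :=
                mul_le_mul hbr hanj (ha0 _) (by positivity)
            _ = (P + 1 + S ^ 2) * S + Λ * S := by ring
            _ ≤ (P + 1 + S ^ 2) * S * Λ + Λ * S := by
                have : (P + 1 + S ^ 2) * S ≤ (P + 1 + S ^ 2) * S * Λ :=
                  le_mul_of_one_le_right (by positivity) hΛ1
                linarith
            _ = (P + 2 + S ^ 2) * S * Λ := by ring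
            _ ≤ (P + 1 + S ^ 2 + S) * (2 * S) * Λ := by
                apply mul_le_mul_of_nonneg_right _ hΛ0
                nlinarith
        · -- `j = 1` (`n = 3`): `a j = a 1 ≤ 2 ≤ S`, `a (n - j) = a (n - 1) ≤ Λ`, `a (n-1)² ≤ Λ`
          have e0 : a j = a 1 := by congr 1; omega
          have e2 : a (n - j) = a (n - 1) := by congr 1; omega
          have hsq : a j ^ 2 ≤ S ^ 2 := by
            rw [e0]; exact pow_le_pow_left₀ (ha0 1) (h1.trans hS) 2
          have hxx : a (n - 1) * a (n - 1) ≤ Λ := by have := ha0 n; rw [hΛ]; nlinarith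
          have hx1 : (P + 1) * a (n - 1) ≤ (P + 1) * Λ := mul_le_mul_of_nonneg_left han1 (by positivity)
          have hx2 : a j ^ 2 * a (n - 1) ≤ S ^ 2 * Λ := mul_le_mul hsq han1 (ha0 _) (by positivity)
          calc (P + 1 + a j ^ 2 + a (j + 1)) * a (n - j)
              = (P + 1) * a (n - 1) + a j ^ 2 * a (n - 1) + a (n - 1) * a (n - 1) := by
                rw [e1, e2]; ring
            _ ≤ (P + 1) * Λ + S ^ 2 * Λ + Λ := by linarith
            _ = (P + 2 + S ^ 2) * Λ := by ring
            _ ≤ (P + 1 + S ^ 2 + S) * (2 * S) * Λ := by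
                apply mul_le_mul_of_nonneg_right _ hΛ0
                nlinarith
    · -- Case C, `j + 1 = n`: top order; the second factor is `a 1 ≤ 2`
      have e0 : a j = a (n - 1) := by congr 1; omega
      have e1 : a (j + 1) = a n := by congr 1; omega
      have hbr : P + 1 + a j ^ 2 + a (j + 1) ≤ (P + 1) * Λ := by
        rw [e0, e1, hΛ]
        have := mul_nonneg hP0 (add_nonneg (sq_nonneg (a (n - 1))) (ha0 n))
        nlinarith
      have h3 : (P + 1) * 2 ≤ (P + 1 + S ^ 2 + S) * (2 * S) :=
        calc (P + 1) * 2 ≤ (P + 1) * (2 * S) :=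
              mul_le_mul_of_nonneg_left (by linarith only [hS]) (by linarith only [hP0])
          _ ≤ (P + 1 + S ^ 2 + S) * (2 * S) :=
              mul_le_mul_of_nonneg_right (by linarith only [sq_nonneg S, hS0])
                (by linarith only [hS0])
      have hfin : (P + 1) * Λ * 2 ≤ (P + 1 + S ^ 2 + S) * (2 * S) * Λ :=
        calc (P + 1) * Λ * 2 = (P + 1) * 2 * Λ := by ring
          _ ≤ (P + 1 + S ^ 2 + S) * (2 * S) * Λ := mul_le_mul_of_nonneg_right h3 hΛ0
      have hpos : 0 ≤ (P + 1) * Λ := mul_nonneg (by linarith only [hP0]) hΛ0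
      have e2 : a (n - j) = a 1 := by congr 1; omega
      have h1a : a 1 ≤ 2 := h1
      rw [e2]
      exact (mul_le_mul hbr h1a (ha0 1) hpos).trans hfin

end Apriori

end Literature.Geometry.Symplectic.JHolomorphicWeierstrassProof

/-!
## Part `SullivanDualTameOrBrodyR4AprioriEnergy`:
### A-priori estimate for `J`-holomorphic maps: part 3, localisation and the energy estimate

Helper file of the lead (c2) for stub `stub_aprioriOf` of line `Sketch`, crux `TameOrBrodyR4`
(stmt-SmoothPoincare4-7826, route SullivanDual). Localisation helpers on `ℂ` (cut-offs, supports, set integrals, basis bounds for squares and fourth powers, word derivatives one and two letters longer), the localised energy estimate `energy_localized` (registered sub-goal; from the `H¹` identity of stub `stub_h1Estimate` with frozen coefficients and absorption), and the pointwise source bound for word derivatives (`source_pointwise`).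
-/

open scoped ContDiff Topology Nat
open Filter Set Literature.Geometry.Symplectic

namespace Literature.Geometry.Symplectic.JHolomorphicWeierstrassProof

variable {d : ℕ}
namespace Apriori

/-! ### Localisation helpers on `ℂ` -/

section StepsHelpers

open MeasureTheory Metric

variable {G : Type*} [NormedAddCommGroup G] [NormedSpace ℝ G]

/-- Outside the topological support the derivative vanishes. [folklore] -/
theorem fderiv_eq_zero_of_notMem_tsupport {f : ℂ → G} {x : ℂ} (hx : x ∉ tsupport f) :
    fderiv ℝ f x = 0 :=
  Function.notMem_support.mp fun h => hx (support_fderiv_subset ℝ h)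

omit [NormedSpace ℝ G] in
/-- A function vanishing off the topological support of a compactly supported function has compact
support. [folklore] -/
theorem hasCompactSupport_of_eq_zero {f : ℂ → G} {H : Type*} [Zero H] {k : ℂ → H}
    (hf : HasCompactSupport f) (h : ∀ x, x ∉ tsupport f → k x = 0) : HasCompactSupport k :=
  HasCompactSupport.intro hf h

/-- An integral of a function vanishing off a set is the set integral. [folklore] -/
theorem integral_eq_setIntegral_of_forall {f : ℂ → ℝ} {S : Set ℂ} (h : ∀ x, x ∉ S → f x = 0) :
    ∫ x, f x = ∫ x in S, f x :=
  (setIntegral_eq_integral_of_forall_compl_eq_zero h).symm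

/-- The derivative of a localised map `χ • w`. [folklore] -/
theorem fderiv_smul_apply' {χ : ℂ → ℝ} {w : ℂ → G} (hχ : ContDiff ℝ ∞ χ) (hw : ContDiff ℝ ∞ w)
    (z v : ℂ) : fderiv ℝ (fun y => χ y • w y) z v = χ z • fderiv ℝ w z v + fderiv ℝ χ z v • w z := by
  rw [fderiv_fun_smul ((hχ.differentiable (by simp)) z) ((hw.differentiable (by simp)) z)]
  simp

/-- Inside the plateau of a bump function, localisation does not change the derivative. [folklore] -/
theorem fderiv_smul_eq_of_mem {χ : ContDiffBump (0 : ℂ)} {w : ℂ → G} {z : ℂ}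
    (hz : z ∈ ball (0 : ℂ) χ.rIn) : fderiv ℝ (fun y => χ y • w y) z = fderiv ℝ w z := by
  apply Filter.EventuallyEq.fderiv_eq
  filter_upwards [χ.eventuallyEq_one_of_mem_ball hz] with y hy
  simp [hy]

/-- A continuous function is integrable on a closed disc. [folklore] -/
theorem integrableOn_closedBall_of_continuous {f : ℂ → ℝ} (hf : Continuous f) (c : ℂ) (r : ℝ) :
    IntegrableOn f (closedBall c r) :=
  hf.continuousOn.integrableOn_compact (isCompact_closedBall c r)

/-- `(∑ f i)⁴ ≤ #s³ ∑ f i⁴` for nonnegative `f`. [folklore] -/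
theorem pow_four_sum_le {ι : Type*} (s : Finset ι) {f : ι → ℝ} (hf : ∀ i ∈ s, 0 ≤ f i) :
    (∑ i ∈ s, f i) ^ 4 ≤ (s.card : ℝ) ^ 3 * ∑ i ∈ s, f i ^ 4 :=
  pow_sum_le_card_mul_sum_pow hf 3

/-- Squared basis bound: `‖T‖² ≤ 2ⁿ ∑_L ‖T(e_L)‖²`. [folklore] -/
theorem sq_norm_le_of_basis
    (hB : ∀ (n : ℕ) (T : ContinuousMultilinearMap ℝ (fun _ : Fin n => ℂ) (EuclideanSpace ℝ (Fin d))),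
      ‖T‖ ≤ ∑ L : Fin n → Fin 2, ‖T (fun j => ![(1 : ℂ), Complex.I] (L j))‖)
    (n : ℕ) (T : ContinuousMultilinearMap ℝ (fun _ : Fin n => ℂ) (EuclideanSpace ℝ (Fin d))) :
    ‖T‖ ^ 2 ≤ (2 : ℝ) ^ n * ∑ L : Fin n → Fin 2, ‖T (fun j => ![(1 : ℂ), Complex.I] (L j))‖ ^ 2 := by
  have h := hB n T
  have hcard : ((Finset.univ : Finset (Fin n → Fin 2)).card : ℝ) = 2 ^ n := by simp
  calc ‖T‖ ^ 2 ≤ (∑ L : Fin n → Fin 2, ‖T (fun j => ![(1 : ℂ), Complex.I] (L j))‖) ^ 2 :=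
        pow_le_pow_left₀ (norm_nonneg _) h 2
    _ ≤ _ := by rw [← hcard]; exact sq_sum_le_card_mul_sum_sq

/-- Fourth-power basis bound: `‖T‖⁴ ≤ 8ⁿ ∑_L ‖T(e_L)‖⁴`. [folklore] -/
theorem pow_four_norm_le_of_basis
    (hB : ∀ (n : ℕ) (T : ContinuousMultilinearMap ℝ (fun _ : Fin n => ℂ) (EuclideanSpace ℝ (Fin d))),
      ‖T‖ ≤ ∑ L : Fin n → Fin 2, ‖T (fun j => ![(1 : ℂ), Complex.I] (L j))‖)
    (n : ℕ) (T : ContinuousMultilinearMap ℝ (fun _ : Fin n => ℂ) (EuclideanSpace ℝ (Fin d))) :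
    ‖T‖ ^ 4 ≤ (8 : ℝ) ^ n * ∑ L : Fin n → Fin 2, ‖T (fun j => ![(1 : ℂ), Complex.I] (L j))‖ ^ 4 := by
  have h := hB n T
  have hcard : ((Finset.univ : Finset (Fin n → Fin 2)).card : ℝ) = 2 ^ n := by simp
  calc ‖T‖ ^ 4 ≤ (∑ L : Fin n → Fin 2, ‖T (fun j => ![(1 : ℂ), Complex.I] (L j))‖) ^ 4 :=
        pow_le_pow_left₀ (norm_nonneg _) h 4
    _ ≤ ((Finset.univ : Finset (Fin n → Fin 2)).card : ℝ) ^ 3 *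
          ∑ L : Fin n → Fin 2, ‖T (fun j => ![(1 : ℂ), Complex.I] (L j))‖ ^ 4 :=
        pow_four_sum_le _ fun L _ => norm_nonneg _
    _ = _ := by
        rw [hcard]
        have h8 : ((2 : ℝ) ^ n) ^ 3 = 8 ^ n := by
          rw [← pow_mul, mul_comm, pow_mul]; norm_num
        rw [h8]

/-- A directional derivative of a word derivative is a longer word derivative:
`‖∂_{e_i} (Dⁿg · e_L)(z)‖ ≤ ‖D^{n+1}g(z)‖`. [folklore] -/
theorem norm_fderiv_word_le {g : ℂ → (EuclideanSpace ℝ (Fin d))} (hg : ContDiff ℝ ∞ g) (n : ℕ) (L : Fin n → Fin 2)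
    (i : Fin 2) (z : ℂ) :
    ‖fderiv ℝ (iteratedFDeriv ℝ n g · (fun j => ![(1 : ℂ), Complex.I] (L j))) z (![(1 : ℂ), Complex.I] i)‖
      ≤ ‖iteratedFDeriv ℝ (n + 1) g z‖ := by
  have h := iteratedFDeriv_succ_apply_eq_fderiv hg n (Fin.cons (![(1 : ℂ), Complex.I] i)
    (fun j => ![(1 : ℂ), Complex.I] (L j))) z
  simp only [Fin.cons_zero, Fin.tail_cons] at h
  have htup : (Fin.cons (![(1 : ℂ), Complex.I] i) (fun j => ![(1 : ℂ), Complex.I] (L j)) :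
      Fin (n + 1) → ℂ) = fun j => ![(1 : ℂ), Complex.I] ((Fin.cons i L : Fin (n + 1) → Fin 2) j) := by
    funext j
    refine Fin.cases ?_ (fun j => ?_) j <;> simp
  have hgoal : fderiv ℝ (iteratedFDeriv ℝ n g · (fun j => ![(1 : ℂ), Complex.I] (L j))) z
      (![(1 : ℂ), Complex.I] i) = iteratedFDeriv ℝ (n + 1) g z
        (fun j => ![(1 : ℂ), Complex.I] ((Fin.cons i L : Fin (n + 1) → Fin 2) j)) := by
    rw [← htup]; exact h.symm
  rw [hgoal]
  exact norm_iteratedFDeriv_apply_basis_le g (n + 1) (Fin.cons i L) z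

/-- Second directional derivatives of a word derivative:
`‖∂_{e_i} ∂_{e_k} (Dⁿg · e_L)(z)‖ ≤ ‖D^{n+2}g(z)‖`. [folklore] -/
theorem norm_fderiv_fderiv_word_le {g : ℂ → (EuclideanSpace ℝ (Fin d))} (hg : ContDiff ℝ ∞ g) (n : ℕ) (L : Fin n → Fin 2)
    (i k : Fin 2) (z : ℂ) :
    ‖fderiv ℝ (fderiv ℝ (iteratedFDeriv ℝ n g · (fun j => ![(1 : ℂ), Complex.I] (L j))) ·
        (![(1 : ℂ), Complex.I] k)) z (![(1 : ℂ), Complex.I] i)‖ ≤ ‖iteratedFDeriv ℝ (n + 2) g z‖ := by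
  -- `∂_k (Dⁿg · e_L) = D^{n+1}g · e_{k::L}`
  have hfun : (fderiv ℝ (iteratedFDeriv ℝ n g · (fun j => ![(1 : ℂ), Complex.I] (L j))) ·
      (![(1 : ℂ), Complex.I] k)) =
      (iteratedFDeriv ℝ (n + 1) g ·
        (fun j => ![(1 : ℂ), Complex.I] ((Fin.cons k L : Fin (n + 1) → Fin 2) j))) := by
    funext y
    have h := iteratedFDeriv_succ_apply_eq_fderiv hg n (Fin.cons (![(1 : ℂ), Complex.I] k)
      (fun j => ![(1 : ℂ), Complex.I] (L j))) y
    simp only [Fin.cons_zero, Fin.tail_cons] at h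
    show fderiv ℝ (iteratedFDeriv ℝ n g · (fun j => ![(1 : ℂ), Complex.I] (L j))) y
        (![(1 : ℂ), Complex.I] k) = iteratedFDeriv ℝ (n + 1) g y _
    rw [← h]
    congr 1
    funext j
    refine Fin.cases ?_ (fun j => ?_) j <;> simp
  rw [hfun]
  exact norm_fderiv_word_le hg (n + 1) (Fin.cons k L) i z

/-- Uniform bound for the derivatives of `J` of order `≤ n` on a closed ball. [folklore] -/
theorem exists_bound_iteratedFDeriv {J : (EuclideanSpace ℝ (Fin d)) → (EuclideanSpace ℝ (Fin d)) →L[ℝ] (EuclideanSpace ℝ (Fin d))} (hJs : ContDiff ℝ ∞ J) (R₀ : ℝ) (n : ℕ) :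
    ∃ M : ℝ, ∀ i, i ≤ n → ∀ x : (EuclideanSpace ℝ (Fin d)), ‖x‖ ≤ R₀ → ‖iteratedFDeriv ℝ i J x‖ ≤ M := by
  have h : ∀ i : ℕ, ∃ Mi : ℝ, ∀ x : (EuclideanSpace ℝ (Fin d)), ‖x‖ ≤ R₀ → ‖iteratedFDeriv ℝ i J x‖ ≤ Mi := fun i => by
    obtain ⟨Mi, hMi⟩ := (isCompact_closedBall (0 : (EuclideanSpace ℝ (Fin d))) R₀).exists_bound_of_continuousOn
      ((hJs.continuous_iteratedFDeriv (m := i) (by exact_mod_cast le_top)).continuousOn)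
    exact ⟨Mi, fun x hx => hMi x (mem_closedBall_zero_iff.mpr hx)⟩
  choose Mi hMi using h
  refine ⟨∑ i ∈ Finset.range (n + 1), |Mi i|, fun i hi x hx => (hMi i x hx).trans ?_⟩
  exact (le_abs_self _).trans
    (Finset.single_le_sum (fun j _ => abs_nonneg (Mi j)) (Finset.mem_range.mpr (by omega)))

end StepsHelpers

/-! ### The localised energy estimate -/

section Energy

open MeasureTheory Metric

/-- **Localised energy estimate with frozen coefficients.** From the `H¹` identity (hypothesis
`h1`, stub `stub_h1Estimate`) for the constant structure `A₀` and `‖A - A₀‖ ≤ ε` on the support of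
the cut-off `χ` with `4(1 + ‖A₀‖²)ε² ≤ 1`:
`∫ ‖∂₁(χw)‖² + ‖∂₂(χw)‖² ≤ 4(1 + ‖A₀‖²) ∫ ‖χ (∂₂w - A ∂₁w) + (∂₂χ) w - (∂₁χ) A w‖²`. [folklore] -/
theorem energy_localized
    (h1 : ∀ (A₀ : (EuclideanSpace ℝ (Fin d)) →L[ℝ] (EuclideanSpace ℝ (Fin d))), (∀ v, A₀ (A₀ v) = -v) → ∀ (W : ℂ → (EuclideanSpace ℝ (Fin d))), ContDiff ℝ ∞ W →
      HasCompactSupport W → (∫ z, (‖fderiv ℝ W z 1‖ ^ 2 + ‖fderiv ℝ W z Complex.I‖ ^ 2)) ≤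
        (1 + ‖A₀‖ ^ 2) * ∫ z, ‖fderiv ℝ W z Complex.I - A₀ (fderiv ℝ W z 1)‖ ^ 2)
    (A₀ : (EuclideanSpace ℝ (Fin d)) →L[ℝ] (EuclideanSpace ℝ (Fin d))) (hA₀ : ∀ v, A₀ (A₀ v) = -v) (A : ℂ → (EuclideanSpace ℝ (Fin d)) →L[ℝ] (EuclideanSpace ℝ (Fin d))) (hA : Continuous A)
    (w : ℂ → (EuclideanSpace ℝ (Fin d))) (hw : ContDiff ℝ ∞ w) (χ : ℂ → ℝ) (hχ : ContDiff ℝ ∞ χ)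
    (hχc : HasCompactSupport χ) (ε : ℝ) (hε : 4 * (1 + ‖A₀‖ ^ 2) * ε ^ 2 ≤ 1)
    (hAε : ∀ z ∈ tsupport χ, ‖A z - A₀‖ ≤ ε) :
    (∫ z, (‖fderiv ℝ (fun y => χ y • w y) z 1‖ ^ 2 +
        ‖fderiv ℝ (fun y => χ y • w y) z Complex.I‖ ^ 2)) ≤
      4 * (1 + ‖A₀‖ ^ 2) * ∫ z, ‖χ z • (fderiv ℝ w z Complex.I - A z (fderiv ℝ w z 1)) +
        fderiv ℝ χ z Complex.I • w z - fderiv ℝ χ z 1 • A z (w z)‖ ^ 2 := by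
  set W : ℂ → (EuclideanSpace ℝ (Fin d)) := fun y => χ y • w y with hWdef
  have hW : ContDiff ℝ ∞ W := hχ.smul hw
  have hWc : HasCompactSupport W := hχc.smul_right
  have hdW : ∀ z v, fderiv ℝ W z v = χ z • fderiv ℝ w z v + fderiv ℝ χ z v • w z :=
    fun z v => fderiv_smul_apply' hχ hw z v
  -- the source `P = ∂₂W - A ∂₁W`
  set P : ℂ → (EuclideanSpace ℝ (Fin d)) := fun z => χ z • (fderiv ℝ w z Complex.I - A z (fderiv ℝ w z 1)) +
    fderiv ℝ χ z Complex.I • w z - fderiv ℝ χ z 1 • A z (w z) with hPdef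
  have hP : ∀ z, fderiv ℝ W z Complex.I - A z (fderiv ℝ W z 1) = P z := by
    intro z
    rw [hdW, hdW]
    simp only [hPdef, map_add, map_smul, smul_sub]
    abel
  -- continuity and compact support of the integrands
  have hcW1 : Continuous fun z => fderiv ℝ W z 1 :=
    (hW.continuous_fderiv (by simp)).clm_apply continuous_const
  have hcWI : Continuous fun z => fderiv ℝ W z Complex.I :=
    (hW.continuous_fderiv (by simp)).clm_apply continuous_const
  have hcP : Continuous P := by
    have : P = fun z => fderiv ℝ W z Complex.I - A z (fderiv ℝ W z 1) :=
      funext fun z => (hP z).symm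
    rw [this]
    exact hcWI.sub (hA.clm_apply hcW1)
  have hzero : ∀ z, z ∉ tsupport χ → fderiv ℝ W z = 0 := by
    intro z hz
    apply fderiv_eq_zero_of_notMem_tsupport
    exact fun h => hz (tsupport_smul_subset_left _ _ h)
  have hsuppE : HasCompactSupport fun z => ‖fderiv ℝ W z 1‖ ^ 2 + ‖fderiv ℝ W z Complex.I‖ ^ 2 :=
    hasCompactSupport_of_eq_zero hχc fun z hz => by simp [hzero z hz]
  have hsuppP : HasCompactSupport fun z => ‖P z‖ ^ 2 :=
    hasCompactSupport_of_eq_zero hχc fun z hz => by simp [← hP, hzero z hz]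
  have hsuppD : HasCompactSupport fun z => ‖fderiv ℝ W z Complex.I - A₀ (fderiv ℝ W z 1)‖ ^ 2 :=
    hasCompactSupport_of_eq_zero hχc fun z hz => by simp [hzero z hz]
  have hiE : Integrable fun z => ‖fderiv ℝ W z 1‖ ^ 2 + ‖fderiv ℝ W z Complex.I‖ ^ 2 :=
    ((hcW1.norm.pow 2).add (hcWI.norm.pow 2)).integrable_of_hasCompactSupport hsuppE
  have hiP : Integrable fun z => ‖P z‖ ^ 2 := (hcP.norm.pow 2).integrable_of_hasCompactSupport hsuppP
  have hiD : Integrable fun z => ‖fderiv ℝ W z Complex.I - A₀ (fderiv ℝ W z 1)‖ ^ 2 :=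
    ((hcWI.sub (A₀.continuous.comp hcW1)).norm.pow 2).integrable_of_hasCompactSupport hsuppD
  -- pointwise: `‖∂₂W - A₀∂₁W‖² ≤ 2‖P‖² + 2ε²(‖∂₁W‖² + ‖∂₂W‖²)`
  have hpt : ∀ z, ‖fderiv ℝ W z Complex.I - A₀ (fderiv ℝ W z 1)‖ ^ 2 ≤
      2 * ‖P z‖ ^ 2 + 2 * ε ^ 2 * (‖fderiv ℝ W z 1‖ ^ 2 + ‖fderiv ℝ W z Complex.I‖ ^ 2) := by
    intro z
    by_cases hz : z ∈ tsupport χ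
    · have hsplit : fderiv ℝ W z Complex.I - A₀ (fderiv ℝ W z 1) =
          P z + (A z - A₀) (fderiv ℝ W z 1) := by
        rw [← hP z, sub_apply]; abel
      have hε0 : 0 ≤ ε := (norm_nonneg _).trans (hAε z hz)
      have hb : ‖(A z - A₀) (fderiv ℝ W z 1)‖ ≤ ε * ‖fderiv ℝ W z 1‖ :=
        (ContinuousLinearMap.le_opNorm _ _).trans
          (mul_le_mul_of_nonneg_right (hAε z hz) (norm_nonneg _))
      rw [hsplit]
      set X := (A z - A₀) (fderiv ℝ W z 1) with hX
      have hn := norm_add_le (P z) X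
      have s1 : ‖P z + X‖ ^ 2 ≤ (‖P z‖ + ‖X‖) ^ 2 := pow_le_pow_left₀ (norm_nonneg _) hn 2
      have s2 : ‖X‖ ^ 2 ≤ (ε * ‖fderiv ℝ W z 1‖) ^ 2 := pow_le_pow_left₀ (norm_nonneg _) hb 2
      have h1' : 0 ≤ ‖fderiv ℝ W z Complex.I‖ ^ 2 := sq_nonneg _
      have hε2 : 0 ≤ ε ^ 2 := sq_nonneg _
      nlinarith [s1, s2, sq_nonneg (‖P z‖ - ‖X‖), mul_nonneg hε2 h1']
    · have h0 := hzero z hz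
      have hl : ‖fderiv ℝ W z Complex.I - A₀ (fderiv ℝ W z 1)‖ = 0 := by rw [h0]; simp
      rw [hl, zero_pow two_ne_zero]
      positivity
  -- integrate and absorb
  have hI := h1 A₀ hA₀ W hW hWc
  have hmono : ∫ z, ‖fderiv ℝ W z Complex.I - A₀ (fderiv ℝ W z 1)‖ ^ 2 ≤
      ∫ z, (2 * ‖P z‖ ^ 2 + 2 * ε ^ 2 * (‖fderiv ℝ W z 1‖ ^ 2 + ‖fderiv ℝ W z Complex.I‖ ^ 2)) :=
    integral_mono hiD ((hiP.const_mul 2).add (hiE.const_mul (2 * ε ^ 2))) hpt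
  have hsplitI : ∫ z, (2 * ‖P z‖ ^ 2 +
      2 * ε ^ 2 * (‖fderiv ℝ W z 1‖ ^ 2 + ‖fderiv ℝ W z Complex.I‖ ^ 2)) =
      2 * (∫ z, ‖P z‖ ^ 2) +
        2 * ε ^ 2 * ∫ z, (‖fderiv ℝ W z 1‖ ^ 2 + ‖fderiv ℝ W z Complex.I‖ ^ 2) := by
    rw [integral_add (hiP.const_mul 2) (hiE.const_mul (2 * ε ^ 2)), integral_const_mul,
      integral_const_mul]
  set E := ∫ z, (‖fderiv ℝ W z 1‖ ^ 2 + ‖fderiv ℝ W z Complex.I‖ ^ 2) with hEdef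
  set Q := ∫ z, ‖P z‖ ^ 2 with hQdef
  have hE0 : 0 ≤ E := integral_nonneg fun z => by positivity
  have hQ0 : 0 ≤ Q := integral_nonneg fun z => by positivity
  have hA0' : 0 ≤ 1 + ‖A₀‖ ^ 2 := by positivity
  have hchain : E ≤ (1 + ‖A₀‖ ^ 2) * (2 * Q + 2 * ε ^ 2 * E) := by
    calc E ≤ (1 + ‖A₀‖ ^ 2) * ∫ z, ‖fderiv ℝ W z Complex.I - A₀ (fderiv ℝ W z 1)‖ ^ 2 := hI
      _ ≤ (1 + ‖A₀‖ ^ 2) * (2 * Q + 2 * ε ^ 2 * E) := by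
          apply mul_le_mul_of_nonneg_left _ hA0'
          rw [← hsplitI]; exact hmono
  -- `2(1+‖A₀‖²)ε² E ≤ E/2`
  have hab : (1 + ‖A₀‖ ^ 2) * (2 * ε ^ 2 * E) ≤ E / 2 := by
    have := mul_le_mul_of_nonneg_right hε hE0
    nlinarith
  nlinarith [hchain, hab, mul_nonneg hA0' hQ0]

end Energy

/-! ### Pointwise preparations for step α -/

section AlphaPrep

open MeasureTheory Metric

/-- The pointwise bound for the source `∂₂w_L - (J∘g) ∂₁w_L` of a word derivative `w_L = Dⁿg · e_L`
(commutator identity + `source_le`). [folklore] -/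
theorem source_pointwise {J : (EuclideanSpace ℝ (Fin d)) → (EuclideanSpace ℝ (Fin d)) →L[ℝ] (EuclideanSpace ℝ (Fin d))} {g : ℂ → (EuclideanSpace ℝ (Fin d))} (hJs : ContDiff ℝ ∞ J)
    (hg : ContDiff ℝ ∞ g) (hgJ : IsJHolomorphicFlat J g) {n : ℕ} (hn : 1 ≤ n) {M S : ℝ} (hS : 2 ≤ S)
    (L : Fin n → Fin 2) (z : ℂ) (hM : ∀ i, i ≤ n → ‖iteratedFDeriv ℝ i J (g z)‖ ≤ M)
    (h1 : ‖fderiv ℝ g z‖ ≤ 2) (hlow : ∀ i, 1 ≤ i → i + 2 ≤ n → ‖iteratedFDeriv ℝ i g z‖ ≤ S) :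
    ‖fderiv ℝ (iteratedFDeriv ℝ n g · (fun j => ![(1 : ℂ), Complex.I] (L j))) z Complex.I -
        J (g z) (fderiv ℝ (iteratedFDeriv ℝ n g · (fun j => ![(1 : ℂ), Complex.I] (L j))) z 1)‖ ≤
      (∑ j ∈ Finset.range n,
        (n.choose (j + 1) : ℝ) * (j + 1)! * M * (S ^ (j + 1) + 1 + S ^ 2 + S) * (2 * S)) *
      (1 + ‖iteratedFDeriv ℝ (n - 1) g z‖ ^ 2 + ‖iteratedFDeriv ℝ n g z‖) := by
  rw [commutator_identity hg hgJ]
  refine (ContinuousMultilinearMap.le_opNorm _ _).trans ?_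
  have hprod : ∏ j : Fin n, ‖(![(1 : ℂ), Complex.I] : Fin 2 → ℂ) (L j)‖ = 1 :=
    Finset.prod_eq_one fun j _ => norm_basis_eq_one (L j)
  rw [hprod, mul_one]
  have h1' : ‖iteratedFDeriv ℝ 1 g z‖ ≤ 2 := (norm_iteratedFDeriv_one g).trans_le h1
  exact source_le hJs hg hn hS z hM h1' hlow

/-- Elementary inequality used to square the pointwise source bound. [folklore] -/
theorem sq_bound_aux {p C D M x y : ℝ} (hp : 0 ≤ p) (hC : 0 ≤ C) (hD : 0 ≤ D) (hM : 0 ≤ M)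
    (hy : 0 ≤ y) (h : p ≤ C * (1 + x ^ 2 + y) + D * y + D * (M * y)) :
    p ^ 2 ≤ 6 * C ^ 2 * (1 + x ^ 4 + y ^ 2) + 2 * D ^ 2 * (1 + M) ^ 2 * y ^ 2 := by
  have hΛ0 : 0 ≤ 1 + x ^ 2 + y := by positivity
  have hΛ2 : (1 + x ^ 2 + y) ^ 2 ≤ 3 * (1 + x ^ 4 + y ^ 2) := by
    nlinarith [sq_nonneg (x ^ 2 - 1), sq_nonneg (y - 1), sq_nonneg (x ^ 2 - y)]
  have hrhs : 0 ≤ C * (1 + x ^ 2 + y) + D * y + D * (M * y) := by positivity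
  have h2 : p ^ 2 ≤ (C * (1 + x ^ 2 + y) + (D * y + D * (M * y))) ^ 2 := by
    rw [← add_assoc]; exact pow_le_pow_left₀ hp h 2
  have h3 : (C * (1 + x ^ 2 + y) + (D * y + D * (M * y))) ^ 2 ≤
      2 * (C * (1 + x ^ 2 + y)) ^ 2 + 2 * (D * y + D * (M * y)) ^ 2 := by
    nlinarith [sq_nonneg (C * (1 + x ^ 2 + y) - (D * y + D * (M * y)))]
  have h4 : 2 * (C * (1 + x ^ 2 + y)) ^ 2 ≤ 6 * C ^ 2 * (1 + x ^ 4 + y ^ 2) := by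
    have := mul_le_mul_of_nonneg_left hΛ2 (by positivity : 0 ≤ 2 * C ^ 2)
    nlinarith
  have h5 : 2 * (D * y + D * (M * y)) ^ 2 = 2 * D ^ 2 * (1 + M) ^ 2 * y ^ 2 := by ring
  linarith

/-- Comparison of constants in step α. [folklore] -/
theorem alpha_const_compare {a M₀ Cs Cχ V I4 I2 : ℝ} (ha : 0 ≤ a) (haM : a ≤ M₀) (hV : 0 ≤ V)
    (hI4 : 0 ≤ I4) (hI2 : 0 ≤ I2) :
    4 * (1 + a ^ 2) * (6 * Cs ^ 2 * (V + I4 + I2) + 2 * Cχ ^ 2 * (1 + M₀) ^ 2 * I2) ≤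
      4 * (1 + M₀ ^ 2) * (6 * Cs ^ 2 * (V + 1) + 2 * Cχ ^ 2 * (1 + M₀) ^ 2) * (1 + I4 + I2) := by
  have h' : a ^ 2 ≤ M₀ ^ 2 := pow_le_pow_left₀ ha haM 2
  have h6 : 0 ≤ 6 * Cs ^ 2 := by positivity
  have h2 : 0 ≤ 2 * Cχ ^ 2 * (1 + M₀) ^ 2 := by positivity
  have hVI : V + I4 + I2 ≤ (V + 1) * (1 + I4 + I2) := by nlinarith
  have hI2' : I2 ≤ 1 + I4 + I2 := by linarith
  have hB1 : 6 * Cs ^ 2 * (V + I4 + I2) + 2 * Cχ ^ 2 * (1 + M₀) ^ 2 * I2 ≤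
      (6 * Cs ^ 2 * (V + 1) + 2 * Cχ ^ 2 * (1 + M₀) ^ 2) * (1 + I4 + I2) := by
    have := mul_le_mul_of_nonneg_left hVI h6
    have := mul_le_mul_of_nonneg_left hI2' h2
    nlinarith
  have hB0 : 0 ≤ 6 * Cs ^ 2 * (V + I4 + I2) + 2 * Cχ ^ 2 * (1 + M₀) ^ 2 * I2 :=
    add_nonneg (mul_nonneg h6 (by linarith)) (mul_nonneg h2 hI2)
  have h4 : 4 * (1 + a ^ 2) ≤ 4 * (1 + M₀ ^ 2) := by linarith
  have h40 : 0 ≤ 4 * (1 + M₀ ^ 2) := by positivity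
  calc 4 * (1 + a ^ 2) * (6 * Cs ^ 2 * (V + I4 + I2) + 2 * Cχ ^ 2 * (1 + M₀) ^ 2 * I2)
      ≤ 4 * (1 + M₀ ^ 2) * (6 * Cs ^ 2 * (V + I4 + I2) + 2 * Cχ ^ 2 * (1 + M₀) ^ 2 * I2) :=
        mul_le_mul_of_nonneg_right h4 hB0
    _ ≤ 4 * (1 + M₀ ^ 2) * ((6 * Cs ^ 2 * (V + 1) + 2 * Cχ ^ 2 * (1 + M₀) ^ 2) * (1 + I4 + I2)) :=
        mul_le_mul_of_nonneg_left hB1 h40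
    _ = _ := by ring

end AlphaPrep

end Apriori

end Literature.Geometry.Symplectic.JHolomorphicWeierstrassProof

end
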